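import Mathlib
import Summits.ValiantsHypothesis.ValiantsHypothesis.Theorems.NewtonUnitEquationsTwoProductsPlanarCellDissociatedLinear
import HarnessLib

/-!
# Crux `TwoProducts` (stmt-ValiantsHypothesis-5906), planar cells for GENERAL tails: the charging principle
# (clean points of a class number at most `m + 1` per cell; every other visible point pins an additive coincidence)

Theory lane (val-lit-p3 g13, CLAIM-FIRST #6, NOTE §15.4).  NO dissociation hypothesis.  Tails supported in `A_j ∌ 0`; the
coefficient of `W = ∏(1+u_j) − ∏(1+v_j)` at a point `p` is the FIBRE SUM `Σ_{a ∈ ∏(A_j ∪ {0}), Σa = p} (F(a) − G(a))`,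
`F(a) = ∏ û_j(a_j)`, `G(a) = ∏ v̂_j(a_j)` (`coeff_tailDiff_eq_fibreSum`).  Fix a cell family `S`, a cell weight `ζ` (valid,
inducing the cell relation), and ANY representation `rep l` of each visible point.  A tuple is CLEAN (`Uniq`) if its point has no
other representation.  THE CHARGING PRINCIPLE (`card_clean_class_le`): a sub-family `C ⊆ S` inside the class
`{F(rep l) ≠ 0, F(rep l) ≠ G(rep l)}` such that for all `l, l₁, l₂ ∈ C` and positions `j ≠ j'` carrying strictly heavier letters
of `l₁, l₂` the three upgraded tuples `rep l ⁺ʲ`, `⁺ʲ'`, `⁺ʲʲ'` are clean, has `#C ≤ m + 1` — the superset argument of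
`planarCell_dissociated_linear` (p603804) run on fibre sums: heavier upgrades are cancelled POINTS, a clean cancelled point gives
`F = G` on its tuple, two improvable positions give the rank-one contradiction, and "point ↦ improvable position" is injective by
letterwise non-domination (pure weights).  CONSEQUENCE (NOTE §15.4): per cell, every visible point beyond `2(m+1)` is DIRTY — one
of its `≤ 2`-position upgrades by heavier visible letters is a MULTIPLY-REPRESENTED point of `Σ_j (A_j ∪ {0})` — an additive,
frontier-local charging of the coincidences of the tail supports; the dissociated `2m + 2` bound is the case with no dirty point.

Honest framing: a structural lemma; it does not bound the number of dirty points (that count, t-dependent, is the remaining content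
of `PlanarCellBound`).  `PlanarCross`, `PlanarCellBound`, the engine and the crux `TwoProducts` are OPEN; `VP ≠ VNP` is NOT proved.
No named facts. [folklore]
-/

noncomputable section

-- Sub = Summit single-conjunct layout: the duplicated namespace component is mandated by the tree.
set_option linter.dupNamespace false

open scoped BigOperators
open MvPolynomial
open Summit.ValiantsHypothesis.ValiantsHypothesis.Theorems.NewtonUnitEquations.TwoProducts.FormalLogLinearisation

namespace Summit.ValiantsHypothesis.ValiantsHypothesis.Theorems.NewtonUnitEquations.TwoProducts.PlanarCell

variable {m : ℕ}

/-- **Fibre sums.**  The coefficient of `∏_j (1 + w_j)` at `p` is `Σ_{a ∈ ∏(A_j ∪ {0}), Σ a = p} ∏_j ŵ_j(a_j)` (no dissociation).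
[folklore] -/
theorem coeff_prod_one_add_eq_fibreSum (w : Fin m → MvPolynomial (Fin 2) ℂ) (A : Fin m → Finset Expo)
    (h0 : ∀ j, (0 : Expo) ∉ A j) (hw : ∀ j, (w j).support ⊆ A j) (p : Expo) :
    coeff p (∏ j, (1 + w j)) =
      ∑ a ∈ (Fintype.piFinset (fun j => insert 0 (A j))).filter (fun a => ∑ j, a j = p),
        ∏ j, hatCoeff (w j) (a j) := by
  classical
  rw [prod_one_add_eq w A h0 hw, coeff_sum, Finset.sum_filter]
  refine Finset.sum_congr rfl fun a _ => ?_
  rw [coeff_monomial]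

/-- **A clean cancelled point gives `F = G` on its tuple.**  If `Σ a` is uniquely represented in `∏(A_j ∪ {0})` then the
coefficient of `W` at `Σ a` is `F(a) − G(a)`. [folklore] -/
theorem coeff_tailDiff_of_uniq (u v : Fin m → MvPolynomial (Fin 2) ℂ) (A : Fin m → Finset Expo)
    (hA0 : ∀ j, (0 : Expo) ∉ A j) (huA : ∀ j, (u j).support ⊆ A j) (hvA : ∀ j, (v j).support ⊆ A j)
    {a : Fin m → Expo} (ha : a ∈ Fintype.piFinset (fun j => insert 0 (A j)))
    (huniq : ∀ b ∈ Fintype.piFinset (fun j => insert 0 (A j)), ∑ j, b j = ∑ j, a j → b = a) :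
    coeff (∑ j, a j) (tailDiff u v) = ∏ j, hatCoeff (u j) (a j) - ∏ j, hatCoeff (v j) (a j) := by
  classical
  have hfilter : (Fintype.piFinset (fun j => insert 0 (A j))).filter (fun b => ∑ j, b j = ∑ j, a j) = {a} := by
    ext b
    simp only [Finset.mem_filter, Finset.mem_singleton]
    constructor
    · rintro ⟨hb, hsum⟩; exact huniq b hb hsum
    · rintro rfl; exact ⟨ha, rfl⟩
  have hW : tailDiff u v = ∏ j, (1 + u j) - ∏ j, (1 + v j) := rfl
  rw [hW, coeff_sub, coeff_prod_one_add_eq_fibreSum u A hA0 huA, coeff_prod_one_add_eq_fibreSum v A hA0 hvA, hfilter,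
    Finset.sum_singleton, Finset.sum_singleton]

/-- **THE CHARGING PRINCIPLE (clean points of a class: at most `m + 1` per cell).**  General tails (no dissociation).  `S` a cell
family, `ζ` a valid weight inducing the cell relation `R`, `rep l ∈ ∏(A_j ∪ {0})` any representation of each `l ∈ S`.  If
`C ⊆ S` lies in the class `F(rep l) ≠ 0 ∧ F(rep l) ≠ G(rep l)` and every upgrade of `rep l` (`l ∈ C`) at one or two positions by
STRICTLY heavier letters of points of `C` is uniquely represented, then `#C ≤ m + 1`. [folklore] -/
theorem card_clean_class_le (u v : Fin m → MvPolynomial (Fin 2) ℂ) (A : Fin m → Finset Expo)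
    (hA0 : ∀ j, (0 : Expo) ∉ A j) (huA : ∀ j, (u j).support ⊆ A j) (hvA : ∀ j, (v j).support ⊆ A j)
    (R : Expo → Expo → Prop) (S : Finset Expo)
    (hS : ∀ l ∈ S, ∃ ξ : Fin 2 → ℝ, ValidWeight u v ξ ∧ IsStrictTop ξ (logSupport u v) l ∧
      ∀ e ∈ tailSupport u v, ∀ e' ∈ tailSupport u v, (R e e' ↔ wt ξ e ≤ wt ξ e'))
    (ζ : Fin 2 → ℝ) (hζval : ValidWeight u v ζ)
    (hRζ : ∀ e ∈ tailSupport u v, ∀ e' ∈ tailSupport u v, (R e e' ↔ wt ζ e ≤ wt ζ e'))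
    (rep : Expo → Fin m → Expo) (hrepPF : ∀ l ∈ S, rep l ∈ Fintype.piFinset (fun j => insert 0 (A j)))
    (hrepsum : ∀ l ∈ S, ∑ j, rep l j = l)
    (C : Finset Expo) (hCS : C ⊆ S)
    (hCF : ∀ l ∈ C, ∏ j, hatCoeff (u j) (rep l j) ≠ 0 ∧
      ∏ j, hatCoeff (u j) (rep l j) ≠ ∏ j, hatCoeff (v j) (rep l j))
    (hclean : ∀ l ∈ C, ∀ l₁ ∈ C, ∀ l₂ ∈ C, ∀ j j' : Fin m, j ≠ j' →
      wt ζ (rep l j) < wt ζ (rep l₁ j) → wt ζ (rep l j') < wt ζ (rep l₂ j') →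
      ∀ a' : Fin m → Expo, (a' = Function.update (rep l) j (rep l₁ j) ∨ a' = Function.update (rep l) j' (rep l₂ j') ∨
          a' = Function.update (Function.update (rep l) j (rep l₁ j)) j' (rep l₂ j')) →
        ∀ b ∈ Fintype.piFinset (fun j => insert 0 (A j)), ∑ i, b i = ∑ i, a' i → b = a') :
    C.card ≤ m + 1 := by
  set PF := Fintype.piFinset (fun j => insert (0 : Expo) (A j)) with hPF
  set T := tailSupport u v with hT
  have hu0 : ∀ j, coeff 0 (u j) = 0 := fun j => notMem_support_iff.1 fun h => hA0 j (huA j h)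
  have hv0 : ∀ j, coeff 0 (v j) = 0 := fun j => notMem_support_iff.1 fun h => hA0 j (hvA j h)
  choose! ξ hval htop hRξ using hS
  have htopW : ∀ l ∈ S, IsStrictTop (ξ l) ↑(tailDiff u v).support l := fun l hl =>
    (stub_logLinearisation m u v hu0 hv0 (ξ l) (hval l hl) l).2 (htop l hl)
  have hsupp : ∀ l ∈ S, l ∈ (tailDiff u v).support := fun l hl => (htopW l hl).1
  have hCS' : ∀ l ∈ C, l ∈ S := fun l hl => hCS hl
  -- letters of points of `C` are `0` or tail exponents (class `F ≠ 0`: all `û` letters nonzero)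
  have hT_of : ∀ (i : Fin m) (e : Expo), hatCoeff (u i) e ≠ 0 → e = 0 ∨ e ∈ T := by
    intro i e hne
    by_cases he : e = 0
    · exact Or.inl he
    · right
      simp only [hatCoeff, he, if_false] at hne
      exact Finset.mem_union_left _ (Finset.mem_biUnion.2 ⟨i, Finset.mem_univ _, mem_support_iff.2 hne⟩)
  have hletter : ∀ l ∈ C, ∀ i, rep l i = 0 ∨ rep l i ∈ T := fun l hl i =>
    hT_of i _ ((Finset.prod_ne_zero_iff.1 (hCF l hl).1) i (Finset.mem_univ _))
  -- comparisons of letters transfer from `ζ` to every witness, `0` on top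
  have hwt0 : ∀ (η : Fin 2 → ℝ), wt η 0 = 0 := fun η => by simp [wt]
  have hval_neg : ∀ l ∈ S, ∀ e ∈ T, wt (ξ l) e < 0 := by
    intro l hl e he
    rcases Finset.mem_union.1 he with h | h
    · obtain ⟨j, -, hj⟩ := Finset.mem_biUnion.1 h
      exact (hval l hl).1 j e hj
    · obtain ⟨j, -, hj⟩ := Finset.mem_biUnion.1 h
      exact (hval l hl).2 j e hj
  have hζ_neg : ∀ e ∈ T, wt ζ e < 0 := by
    intro e he
    rcases Finset.mem_union.1 he with h | h
    · obtain ⟨j, -, hj⟩ := Finset.mem_biUnion.1 h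
      exact hζval.1 j e hj
    · obtain ⟨j, -, hj⟩ := Finset.mem_biUnion.1 h
      exact hζval.2 j e hj
  have transfer : ∀ l ∈ S, ∀ p q : Expo, (p = 0 ∨ p ∈ T) → (q = 0 ∨ q ∈ T) →
      wt ζ q ≤ wt ζ p → wt (ξ l) q ≤ wt (ξ l) p := by
    intro l hl p q hp hq hle
    rcases hp with rfl | hp
    · rcases hq with rfl | hq
      · exact le_rfl
      · rw [hwt0]; exact (hval_neg l hl q hq).le
    · rcases hq with rfl | hq
      · exfalso
        rw [hwt0] at hle
        linarith [hζ_neg p hp]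
      · exact (hRξ l hl q hq p hp).1 ((hRζ q hq p hp).2 hle)
  have stransfer : ∀ l ∈ S, ∀ p q : Expo, (p = 0 ∨ p ∈ T) → (q = 0 ∨ q ∈ T) →
      wt ζ q < wt ζ p → wt (ξ l) q < wt (ξ l) p := by
    intro l hl p q hp hq hlt
    rcases hp with rfl | hp
    · rcases hq with rfl | hq
      · exact absurd hlt (lt_irrefl _)
      · rw [hwt0]; exact hval_neg l hl q hq
    · rcases hq with rfl | hq
      · exfalso
        rw [hwt0] at hlt
        linarith [hζ_neg p hp]
      · by_contra hle
        have h1 : wt ζ p ≤ wt ζ q := (hRζ p hp q hq).1 ((hRξ l hl p hp q hq).2 (not_lt.1 hle))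
        exact absurd hlt (not_lt.2 h1)
  -- the weight of a point of `C` is the sum of the weights of its letters
  have hwt_rep : ∀ (η : Fin 2 → ℝ), ∀ l ∈ S, wt η l = ∑ j, wt η (rep l j) := by
    intro η l hl
    conv_lhs => rw [← hrepsum l hl]
    exact wt_sum η _ _
  -- cancellation: a tuple of letters (each `0` or in `T`), letterwise no lighter than `rep l`, strictly heavier somewhere,
  -- has a point outside `supp W`
  have hcancel : ∀ l ∈ C, ∀ a' : Fin m → Expo, (∀ i, a' i = 0 ∨ a' i ∈ T) → (∀ i, wt ζ (rep l i) ≤ wt ζ (a' i)) →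
      (∃ i, wt ζ (rep l i) < wt ζ (a' i)) → coeff (∑ j, a' j) (tailDiff u v) = 0 := by
    intro l hl a' hT' hle ⟨i₀, hi₀⟩
    have hlS := hCS' l hl
    have hgt : wt (ξ l) l < wt (ξ l) (∑ j, a' j) := by
      rw [hwt_rep (ξ l) l hlS, wt_sum]
      refine Finset.sum_lt_sum (fun i _ => transfer l hlS (a' i) (rep l i) (hT' i) (hletter l hl i) (hle i)) ?_
      exact ⟨i₀, Finset.mem_univ _, stransfer l hlS (a' i₀) (rep l i₀) (hT' i₀) (hletter l hl i₀) hi₀⟩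
    by_contra h
    have hmem : (∑ j, a' j) ∈ ((tailDiff u v).support : Set Expo) := mem_support_iff.2 h
    have hne : (∑ j, a' j) ≠ l := fun heq => by rw [heq] at hgt; exact lt_irrefl _ hgt
    have := (htopW l hlS).2 _ hmem hne
    exact absurd hgt (not_lt.2 this.le)
  -- two points of `C` never dominate each other letterwise
  have hnodom : ∀ l ∈ C, ∀ l' ∈ C, l ≠ l' → ∃ j, wt ζ (rep l j) < wt ζ (rep l' j) := by
    intro l hl l' hl' hne
    by_contra hno
    push Not at hno
    have hge : wt (ξ l') l' ≤ wt (ξ l') l := by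
      rw [hwt_rep (ξ l') l (hCS' l hl), hwt_rep (ξ l') l' (hCS' l' hl')]
      exact Finset.sum_le_sum fun i _ =>
        transfer l' (hCS' l' hl') (rep l i) (rep l' i) (hletter l hl i) (hletter l' hl' i) (hno i)
    have := (htopW l' (hCS' l' hl')).2 l (hsupp l (hCS' l hl)) hne
    exact absurd hge (not_le.2 this)
  -- membership of upgrades in `PF`
  have hPFupd : ∀ l ∈ C, ∀ l₁ ∈ C, ∀ j, Function.update (rep l) j (rep l₁ j) ∈ PF := by
    intro l hl l₁ hl₁ j
    rw [hPF, Fintype.mem_piFinset]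
    intro i
    by_cases hi : i = j
    · subst hi; rw [Function.update_self]; exact Fintype.mem_piFinset.1 (hPF ▸ hrepPF l₁ (hCS' l₁ hl₁)) i
    · rw [Function.update_of_ne hi]; exact Fintype.mem_piFinset.1 (hPF ▸ hrepPF l (hCS' l hl)) i
  have hPFupd2 : ∀ l ∈ C, ∀ l₁ ∈ C, ∀ l₂ ∈ C, ∀ j j',
      Function.update (Function.update (rep l) j (rep l₁ j)) j' (rep l₂ j') ∈ PF := by
    intro l hl l₁ hl₁ l₂ hl₂ j j'
    rw [hPF, Fintype.mem_piFinset]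
    intro i
    by_cases hi : i = j'
    · subst hi; rw [Function.update_self]; exact Fintype.mem_piFinset.1 (hPF ▸ hrepPF l₂ (hCS' l₂ hl₂)) i
    · rw [Function.update_of_ne hi]
      exact Fintype.mem_piFinset.1 (hPF ▸ hPFupd l hl l₁ hl₁ j) i
  -- improvable positions: at most one per point of `C`
  have himp : ∀ l ∈ C, ∀ j j' : Fin m, ∀ l₁ ∈ C, ∀ l₂ ∈ C,
      wt ζ (rep l j) < wt ζ (rep l₁ j) → wt ζ (rep l j') < wt ζ (rep l₂ j') → j = j' := by
    intro l hl j j' l₁ hl₁ l₂ hl₂ hj hj'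
    by_contra hjj
    set a := rep l with ha
    set p := rep l₁ j with hp
    set p' := rep l₂ j' with hp'
    have hT1 : ∀ i, Function.update a j p i = 0 ∨ Function.update a j p i ∈ T := by
      intro i; by_cases hi : i = j
      · subst hi; rw [Function.update_self]; exact hletter l₁ hl₁ i
      · rw [Function.update_of_ne hi]; exact hletter l hl i
    have hT2 : ∀ i, Function.update a j' p' i = 0 ∨ Function.update a j' p' i ∈ T := by
      intro i; by_cases hi : i = j'
      · subst hi; rw [Function.update_self]; exact hletter l₂ hl₂ i
      · rw [Function.update_of_ne hi]; exact hletter l hl i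
    have hT12 : ∀ i, Function.update (Function.update a j p) j' p' i = 0 ∨
        Function.update (Function.update a j p) j' p' i ∈ T := by
      intro i; by_cases hi : i = j'
      · subst hi; rw [Function.update_self]; exact hletter l₂ hl₂ i
      · rw [Function.update_of_ne hi]; exact hT1 i
    have hle1 : ∀ i, wt ζ (a i) ≤ wt ζ (Function.update a j p i) := by
      intro i; by_cases hi : i = j
      · subst hi; rw [Function.update_self]; exact hj.le
      · rw [Function.update_of_ne hi]
    have hle2 : ∀ i, wt ζ (a i) ≤ wt ζ (Function.update a j' p' i) := by
      intro i; by_cases hi : i = j'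
      · subst hi; rw [Function.update_self]; exact hj'.le
      · rw [Function.update_of_ne hi]
    have hle12 : ∀ i, wt ζ (a i) ≤ wt ζ (Function.update (Function.update a j p) j' p' i) := by
      intro i; by_cases hi : i = j'
      · subst hi; rw [Function.update_self]; exact hj'.le
      · rw [Function.update_of_ne hi]; exact hle1 i
    have hlt1 : ∃ i, wt ζ (a i) < wt ζ (Function.update a j p i) := ⟨j, by rw [Function.update_self]; exact hj⟩
    have hlt2 : ∃ i, wt ζ (a i) < wt ζ (Function.update a j' p' i) := ⟨j', by rw [Function.update_self]; exact hj'⟩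
    have hlt12 : ∃ i, wt ζ (a i) < wt ζ (Function.update (Function.update a j p) j' p' i) :=
      ⟨j', by rw [Function.update_self]; exact hj'⟩
    -- the three cancelled clean points give `F = G` on their tuples
    have hcl := hclean l hl l₁ hl₁ l₂ hl₂ j j' hjj hj hj'
    have c1 : ∏ i, hatCoeff (u i) (Function.update a j p i) = ∏ i, hatCoeff (v i) (Function.update a j p i) := by
      have h := hcancel l hl _ hT1 hle1 hlt1
      rw [coeff_tailDiff_of_uniq u v A hA0 huA hvA (hPFupd l hl l₁ hl₁ j) (hcl _ (Or.inl rfl))] at h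
      exact sub_eq_zero.1 h
    have c2 : ∏ i, hatCoeff (u i) (Function.update a j' p' i) = ∏ i, hatCoeff (v i) (Function.update a j' p' i) := by
      have h := hcancel l hl _ hT2 hle2 hlt2
      rw [coeff_tailDiff_of_uniq u v A hA0 huA hvA (hPFupd l hl l₂ hl₂ j') (hcl _ (Or.inr (Or.inl rfl)))] at h
      exact sub_eq_zero.1 h
    have c12 : ∏ i, hatCoeff (u i) (Function.update (Function.update a j p) j' p' i) =
        ∏ i, hatCoeff (v i) (Function.update (Function.update a j p) j' p' i) := by
      have h := hcancel l hl _ hT12 hle12 hlt12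
      rw [coeff_tailDiff_of_uniq u v A hA0 huA hvA (hPFupd2 l hl l₁ hl₁ l₂ hl₂ j j')
        (hcl _ (Or.inr (Or.inr rfl)))] at h
      exact sub_eq_zero.1 h
    -- rank-one identities and the nonvanishing of `F(a⁺ʲʲ')`
    have idF := prod_mul_prod_update_update (fun i e => hatCoeff (u i) e) a hjj p p'
    have idG := prod_mul_prod_update_update (fun i e => hatCoeff (v i) e) a hjj p p'
    have hF12 : ∏ i, hatCoeff (u i) (Function.update (Function.update a j p) j' p' i) ≠ 0 := by
      rw [Finset.prod_ne_zero_iff]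
      intro i _
      by_cases hi : i = j'
      · subst hi; rw [Function.update_self]
        exact (Finset.prod_ne_zero_iff.1 (hCF l₂ hl₂).1) i (Finset.mem_univ _)
      · rw [Function.update_of_ne hi]
        by_cases hi2 : i = j
        · subst hi2; rw [Function.update_self]
          exact (Finset.prod_ne_zero_iff.1 (hCF l₁ hl₁).1) i (Finset.mem_univ _)
        · rw [Function.update_of_ne hi2]
          exact (Finset.prod_ne_zero_iff.1 (hCF l hl).1) i (Finset.mem_univ _)
    apply (hCF l hl).2
    have key : (∏ i, hatCoeff (u i) (a i) - ∏ i, hatCoeff (v i) (a i)) *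
        ∏ i, hatCoeff (u i) (Function.update (Function.update a j p) j' p' i) = 0 := by
      rw [sub_mul, idF, c1, c2, ← idG, c12]
      ring
    rcases mul_eq_zero.1 key with h | h
    · exact sub_eq_zero.1 h
    · exact absurd h hF12
  -- the injection into `Option (Fin m)`
  classical
  let Φ : Expo → Option (Fin m) := fun l =>
    if h : ∃ j : Fin m, ∃ l' ∈ C, wt ζ (rep l j) < wt ζ (rep l' j) then some (Classical.choose h) else none
  have hΦspec : ∀ l ∈ C, ∀ j, Φ l = some j → ∃ l' ∈ C, wt ζ (rep l j) < wt ζ (rep l' j) := by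
    intro l _ j hj
    simp only [Φ] at hj
    split_ifs at hj with h
    · have := Classical.choose_spec h
      rw [Option.some.injEq] at hj
      rwa [← hj]
  have hΦnone : ∀ l ∈ C, Φ l = none → ∀ j, ∀ l' ∈ C, ¬ wt ζ (rep l j) < wt ζ (rep l' j) := by
    intro l _ hnone j l' hl' hlt
    simp only [Φ] at hnone
    split_ifs at hnone with h
    exact h ⟨j, l', hl', hlt⟩
  have hinj : Set.InjOn Φ ↑C := by
    intro l hl l' hl' heq
    by_contra hne
    obtain ⟨j, hj⟩ := hnodom l hl l' hl' hne
    obtain ⟨j', hj'⟩ := hnodom l' hl' l hl (Ne.symm hne)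
    rcases hΦ : Φ l with _ | i
    · exact hΦnone l hl hΦ j l' hl' hj
    · obtain ⟨l₁, hl₁, hlt₁⟩ := hΦspec l hl i hΦ
      have hi : i = j := himp l hl i j l₁ hl₁ l' hl' hlt₁ hj
      rw [hΦ] at heq
      obtain ⟨l₂, hl₂, hlt₂⟩ := hΦspec l' hl' i heq.symm
      have hi' : i = j' := himp l' hl' i j' l₂ hl₂ l hl hlt₂ hj'
      rw [← hi] at hj; rw [← hi'] at hj'
      exact absurd (hj.trans hj') (lt_irrefl _)
  calc C.card ≤ (Finset.univ : Finset (Option (Fin m))).card :=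
        Finset.card_le_card_of_injOn Φ (fun _ _ => Finset.mem_univ _) hinj
    _ = m + 1 := by simp

end Summit.ValiantsHypothesis.ValiantsHypothesis.Theorems.NewtonUnitEquations.TwoProducts.PlanarCell

end
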